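import Literature.MathematicalPhysics.QuantumLattice.GrassmannLaplacianGramBound
import Literature.MathematicalPhysics.QuantumLattice.GrassmannLaplacianTreeExpansion
import Literature.MathematicalPhysics.QuantumLattice.GrassmannMonomialDeletion
import Mathlib.Algebra.BigOperators.Fin
import HarnessLib

/-!
# Flattening a family of monomials: `∏_v ψ(Y_v) = ψ(flat Y)` and the multilinear expansion of `𝓔ᵀ`

Topic `Literature/MathematicalPhysics/QuantumLattice`; bookkeeping for the single-scale estimate in the
Laplacian host.  The vertices of the tree expansion are indexed by `v : Fin n` and carry monomials
`ψ(Y_v(0))⋯ψ(Y_v(m_v - 1))` of (even) degrees `m_v`; the product over the vertices (taken in the commutative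
even part `⋀^{even}`, `GrassmannTruncatedSpectators.lean`) is ONE monomial in the **flattened** label string
`flat Y : Fin (Σ_v m_v) → Γ` (Mathlib's `finSigmaFinEquiv`: the positions of vertex `v` form the block
`[Σ_{u<v} m_u, Σ_{u≤v} m_u)`):

* `flat`, `flat_apply_equiv` (`flat Y (e ⟨v, j⟩) = Y_v(j)`), `flat_eq_append_comp` (peeling the last vertex),
  **`genProd_flat`** (`ψ(flat Y) = ∏_v ψ(Y_v)` as an ordered product), `coe_prod_evenGenProd` (the same for the
  product in `⋀^{even}`);
* **`coe_ursellOf_convMoment_kernelVertex`** — for vertices `M_v = Σ_{Y_v} K_v(Y_v) ψ(Y_v)` given by kernels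
  (even degrees), the truncated expectation of the Laplacian-host tree formula
  (`ursellOf_convMoment_eq_treeOp`) is the kernel-weighted sum over the label families of the tree operator
  applied to the flattened monomials:
  `𝓔ᵀ_C(M_v : v) = Σ_Y (∏_v K_v(Y_v)) · treeOp v₀ (ψ(flat Y))` — multilinearity, the form in which the
  kernel bounds of `GrassmannLaplacianScriptBound.lean` are summed against the vertex kernels
  (Benfatto–Giuliani–Mastropietro 2006, (2.66)–(2.70)).

Everything is proved; no named fact.

## Sources

G. Benfatto, A. Giuliani, V. Mastropietro, Ann. Henri Poincaré 7 (2006) 809–898, (2.66)–(2.70)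
(`BenfattoGiulianiMastropietro2006`); M. Salmhofer, *Renormalization* (1999), §4.3 (`Salmhofer1999`).
-/

noncomputable section

namespace Literature.MathematicalPhysics.QuantumLattice

open GrassmannAlgebra Finset
open Literature.Probability.LatticeModels

/-! ### The flattened label string -/

section Flat

variable {Γ : Type*} {n : ℕ} {deg : Fin n → ℕ}

/-- The **flattened label string** of a family of label tuples `Y_v : Fin (m_v) → Γ`, `v : Fin n`: position
`Σ_{u<v} m_u + j` carries `Y_v(j)` (Mathlib's `finSigmaFinEquiv`). [folklore] -/
def flat (Ys : ∀ v : Fin n, Fin (deg v) → Γ) : Fin (∑ v, deg v) → Γ :=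
  fun i => Ys (finSigmaFinEquiv.symm i).1 (finSigmaFinEquiv.symm i).2

/-- The label at the position of `(v, j)`. [folklore] -/
@[simp] theorem flat_apply_equiv (Ys : ∀ v : Fin n, Fin (deg v) → Γ) (v : Fin n) (j : Fin (deg v)) :
    flat Ys (finSigmaFinEquiv ⟨v, j⟩) = Ys v j :=
  congrArg (fun x : (Σ v : Fin n, Fin (deg v)) => Ys x.1 x.2) (finSigmaFinEquiv.symm_apply_apply ⟨v, j⟩)

end Flat

section FlatSucc

variable {Γ : Type*} {n : ℕ} (deg : Fin (n + 1) → ℕ)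

/-- The number of positions splits off the last vertex. [folklore] -/
theorem sum_eq_sum_castSucc_add_last : (∑ v, deg v) = (∑ v : Fin n, deg v.castSucc) + deg (Fin.last n) :=
  Fin.sum_univ_castSucc deg

/-- The positions of an earlier vertex, read in the block decomposition. [folklore] -/
theorem cast_finSigmaFinEquiv_castSucc (v : Fin n) (j : Fin (deg v.castSucc)) :
    Fin.cast (sum_eq_sum_castSucc_add_last deg) (finSigmaFinEquiv ⟨v.castSucc, j⟩) =
      Fin.castAdd (deg (Fin.last n)) (finSigmaFinEquiv (n := fun u : Fin n => deg u.castSucc) ⟨v, j⟩) := by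
  refine Fin.ext ?_
  rw [Fin.val_cast, finSigmaFinEquiv_apply, Fin.val_castAdd, finSigmaFinEquiv_apply]
  change (∑ i : Fin (v : ℕ), deg (Fin.castLE _ i)) + (j : ℕ) = (∑ i : Fin (v : ℕ), deg (Fin.castSucc (Fin.castLE _ i))) + (j : ℕ)
  exact congrArg (· + (j : ℕ)) (sum_congr rfl fun i _ => congrArg deg (Fin.ext rfl))

/-- The positions of the last vertex, read in the block decomposition. [folklore] -/
theorem cast_finSigmaFinEquiv_last (j : Fin (deg (Fin.last n))) :
    Fin.cast (sum_eq_sum_castSucc_add_last deg) (finSigmaFinEquiv ⟨Fin.last n, j⟩) =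
      Fin.natAdd (∑ v : Fin n, deg v.castSucc) j := by
  refine Fin.ext ?_
  rw [Fin.val_cast, finSigmaFinEquiv_apply, Fin.val_natAdd]
  change (∑ i : Fin n, deg (Fin.castLE _ i)) + (j : ℕ) = (∑ v : Fin n, deg v.castSucc) + (j : ℕ)
  exact congrArg (· + (j : ℕ)) (sum_congr rfl fun i _ => congrArg deg (Fin.ext rfl))

/-- **Peeling the last vertex**: the flattened string is the flattened string of the first `n` vertices
followed by the last tuple. [folklore] -/
theorem flat_eq_append_comp (Ys : ∀ v : Fin (n + 1), Fin (deg v) → Γ) :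
    flat Ys = Fin.append (flat (deg := fun u : Fin n => deg u.castSucc) fun v => Ys v.castSucc) (Ys (Fin.last n)) ∘
      finCongr (sum_eq_sum_castSucc_add_last deg) := by
  funext i
  obtain ⟨⟨v, j⟩, rfl⟩ := finSigmaFinEquiv.surjective i
  rw [flat_apply_equiv, Function.comp_apply, finCongr_apply]
  induction v using Fin.lastCases with
  | last => rw [cast_finSigmaFinEquiv_last, Fin.append_right]
  | cast v => rw [cast_finSigmaFinEquiv_castSucc, Fin.append_left, flat_apply_equiv]

end FlatSucc

/-! ### The product of the monomials is the monomial of the flattened string -/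

section GenProdFlat

variable (R : Type*) [CommRing R] {Γ : Type*} [DecidableEq Γ]

/-- **`ψ(flat Y) = ∏_v ψ(Y_v)`** as an ordered product (first vertex first). [folklore] -/
theorem genProd_flat : ∀ {n : ℕ} {deg : Fin n → ℕ} (Ys : ∀ v : Fin n, Fin (deg v) → Γ),
    genProd R (flat Ys) = (List.ofFn fun v => genProd R (Ys v)).prod
  | 0, deg, Ys => by
    rw [List.ofFn_zero, List.prod_nil]
    have h0 : (∑ v : Fin 0, deg v) = 0 := rfl
    exact (genProd_comp_finCongr R h0.symm (flat Ys)).symm.trans (by rw [show (flat Ys ∘ finCongr h0.symm : Fin 0 → Γ) = Fin.elim0 from funext fun i => i.elim0, genProd_zero])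
  | n + 1, deg, Ys => by
    rw [flat_eq_append_comp, genProd_comp_finCongr, genProd_append, genProd_flat (fun v => Ys v.castSucc), List.ofFn_succ',
      List.prod_concat]

variable {R}

/-- The even element `ψ(Y)` of an even-degree tuple. [folklore] -/
def evenGenProd {m : ℕ} (hm : Even m) (Y : Fin m → Γ) : evenPart R Γ :=
  ⟨genProd R Y, by
    have h := genProd_mem_evenOdd R Y
    rwa [ZMod.natCast_eq_zero_iff_even.2 hm] at h⟩

/-- Unfolding `evenGenProd`. [folklore] -/
@[simp] theorem coe_evenGenProd {m : ℕ} (hm : Even m) (Y : Fin m → Γ) :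
    (evenGenProd (R := R) hm Y : GrassmannAlgebra R Γ) = genProd R Y := rfl

/-- **The product of the even monomials of the vertices, taken in `⋀^{even}`, is the monomial of the flattened
string.** [folklore] -/
theorem coe_prod_evenGenProd {n : ℕ} {deg : Fin n → ℕ} (hm : ∀ v, Even (deg v)) (Ys : ∀ v : Fin n, Fin (deg v) → Γ) :
    ((∏ v, evenGenProd (R := R) (hm v) (Ys v) : evenPart R Γ) : GrassmannAlgebra R Γ) = genProd R (flat Ys) := by
  rw [← Fin.prod_ofFn, SubmonoidClass.coe_list_prod, List.map_ofFn, genProd_flat]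
  rfl

end GenProdFlat

/-! ### The multilinear expansion of the truncated expectation of kernel vertices -/

section Multilinear

variable (R : Type*) [CommRing R] [Algebra ℚ R] {Γ : Type*} [Fintype Γ] [DecidableEq Γ] {n : ℕ}
variable (C : Matrix Γ Γ R) (cl : Γ → Fin n) {deg : Fin n → ℕ} (hm : ∀ v, Even (deg v))
variable (K : ∀ v : Fin n, (Fin (deg v) → Γ) → R)

/-- The **kernel vertex** `M_v = Σ_{Y_v} K_v(Y_v) ψ(Y_v(0))⋯ψ(Y_v(m_v - 1))` of even degree `m_v`, an element of
`⋀^{even}`. [folklore] -/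
def kernelVertex (v : Fin n) : evenPart R Γ := ∑ Yv : Fin (deg v) → Γ, K v Yv • evenGenProd (hm v) Yv

omit [Algebra ℚ R] in
/-- **Multilinearity**: the product of the kernel vertices is the kernel-weighted sum over the label families
of the products of the monomials. [folklore] -/
theorem prod_kernelVertex :
    ∏ v, kernelVertex R hm K v = ∑ Ys : ∀ v, Fin (deg v) → Γ, (∏ v, K v (Ys v)) • ∏ v, evenGenProd (hm v) (Ys v) := by
  simp only [kernelVertex]
  rw [prod_univ_sum, Fintype.piFinset_univ]
  refine sum_congr rfl fun Ys _ => ?_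
  simp only [Algebra.smul_def, prod_mul_distrib, map_prod]

omit [Algebra ℚ R] in
/-- Kernel vertices with kernels supported on the labels of their cluster are supported there. [folklore] -/
theorem coe_kernelVertex_mem (hK : ∀ v Yv, K v Yv ≠ 0 → ∀ j, cl (Yv j) = v) (v : Fin n) :
    (kernelVertex R hm K v : GrassmannAlgebra R Γ) ∈ fieldSubalgebra R (cl ⁻¹' {v}) := by
  rw [kernelVertex, AddSubmonoidClass.coe_finsetSum]
  refine Subalgebra.sum_mem _ fun Yv _ => ?_
  rw [Subalgebra.coe_smul, coe_evenGenProd]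
  by_cases h : K v Yv = 0
  · rw [h, zero_smul]; exact zero_mem _
  · refine Subalgebra.smul_mem _ (fieldSubalgebra_mono R ?_ (genProd_mem_fieldSubalgebra_range R Yv)) _
    rintro _ ⟨j, rfl⟩
    exact hK v Yv h j

/-- **The truncated expectation of kernel vertices is the kernel-weighted sum of the tree operator on the
flattened monomials**: for every root `v₀`,
`𝓔ᵀ_C(M_v : v) = Σ_Y (∏_v K_v(Y_v)) treeOp v₀ (ψ(flat Y))` (the tree formula
`ursellOf_convMoment_eq_treeOp` and multilinearity; Benfatto–Giuliani–Mastropietro 2006, (2.66)–(2.70)).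
[cite: BenfattoGiulianiMastropietro2006, (2.66)-(2.70)] -/
theorem coe_ursellOf_convMoment_kernelVertex (hK : ∀ v Yv, K v Yv ≠ 0 → ∀ j, cl (Yv j) = v) (v₀ : Fin n) :
    ((ursellOf (convMoment R C (kernelVertex R hm K)) univ : evenPart R Γ) : GrassmannAlgebra R Γ) =
      ∑ Ys : ∀ v, Fin (deg v) → Γ, (∏ v, K v (Ys v)) •
        ((treeOp R C cl v₀ univ : laplacianAlgebra R C cl) : Module.End R (GrassmannAlgebra R Γ)) (genProd R (flat Ys)) := by
  rw [ursellOf_convMoment_eq_treeOp R C cl (coe_kernelVertex_mem R cl hm K hK) univ (mem_univ v₀), prod_kernelVertex, map_sum,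
    AddSubmonoidClass.coe_finsetSum]
  refine sum_congr rfl fun Ys _ => ?_
  rw [map_smul, Subalgebra.coe_smul, coe_onEven_apply, coe_prod_evenGenProd]

end Multilinear

end Literature.MathematicalPhysics.QuantumLattice
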